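import Literature.NumberTheory.Transcendental.RoySmallValueSupProd
import Literature.NumberTheory.Transcendental.RoySmallValueFactorization
import HarnessLib

/-!
# Roy's small value estimate for `𝔾ₐ × 𝔾ₘ` — Step 2, the product inequality on a convex body

Topic `Literature/NumberTheory/Transcendental`. Part of the formalisation of the proof of Roy 2013,
Theorem 1.1 (named fact `roy2013_thm_1_1`, `RoySmallValueEstimates.lean`). Source: D. Roy,
*A small value estimate for `𝔾ₐ × 𝔾ₘ`*, Mathematika 59 (2013) 333–363 = arXiv:1301.0663, §2,
Propositions 2.3–2.4 and §7, Step 2 (pp. 7, 18 of the arXiv text):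

> `F(P) = a ∏_{α ∈ Z} P(α)` [...] Proposition 3.7 (i) of [LR] gives
> `|h_𝒞(Z) − log|a| − ∑_α log sup{|P(α)| ; P ∈ 𝒞}| ≤ 2 log(m+1) D deg(Z)` [...]
> `∑_{α ∈ Z} log sup{|P(α)| ; P ∈ 𝒞_D} ≤ h_{𝒞_D}(Z) − D h(Z) + 9 log(3) D deg(Z)`.

For `F = Φ(P, Q, ·) = c ∏_j ℓ_{α_j}^{e_j}` (`royF_eq_C_mul_prod`) and a convex body `𝒞` of forms
of degree `D` in Roy's sense (`λR + μS ∈ 𝒞` for `|λ| + |μ| ≤ 1`), we prove the TEST-FAMILY form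
of the displayed comparison (`step2_core`): for every family `(R_j)` of elements of `𝒞`,

  `|c| ∏_j |R_j(α_j)|^{e_j} ≤ 4^{k 2^k} · sup_{R ∈ 𝒞} |Φ(P, Q, R)|`     (`∑ e_j ≤ 2^k`),

from the product lemma `prod_norm_le_of_prod_bound` (`RoySmallValueSupProd`, replacing [LR]
Prop. 3.7) applied to the `∑ e_j` linear forms `R ↦ R(α_j)` (repeated `e_j` times) and the
identity `Φ(P, Q, R) = c ∏_j R(α_j)^{e_j}` for `R ∈ ℂ[X]_D` (`eval_royF`, `eval_evalForm_coeff`).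
Everything is proved; no definitions, no named facts.

## References

* [Roy2013] D. Roy, *A small value estimate for 𝔾ₐ × 𝔾ₘ*, Mathematika 59 (2013), 333–363
  (arXiv:1301.0663), Propositions 2.3, 2.4 and §7, Step 2.
-/

noncomputable section

open MvPolynomial Finset

namespace Literature.NumberTheory.Transcendental

namespace Roy2013

variable {D : ℕ} {M₁ M₂ : Finset (Fin 3 →₀ ℕ)}

/-- `Φ(P, Q, R) = c ∏_j R(α_j)^{e_j}` for `R ∈ ℂ[X]_D`, from the factorisation of `F`.
[cite: Roy2013, §6, (6.4)] -/
theorem royPhi_eq_of_royF_eq (hM₁ : ∀ μ ∈ M₁, μ.degree = 2 * D) (hM₂ : ∀ μ ∈ M₂, μ.degree = 2 * D)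
    (σ : PhiCol D M₁ M₂ ≃ PhiRow D) {P Q : CX} {m : ℕ} {α : Fin m → (Fin 3 → ℂ)} {c : ℂ}
    {e : Fin m → ℕ} (hFeq : royF D M₁ M₂ σ P Q = C c * ∏ i, evalForm D (α i) ^ e i)
    {R : CX} (hR : R.IsHomogeneous D) :
    royPhi D M₁ M₂ σ ![P, Q, R] = c * ∏ i, eval (α i) R ^ e i := by
  rw [← eval_royF hM₁ hM₂ σ P Q R, hFeq, map_mul, eval_C, map_prod]
  congr 1
  exact Finset.prod_congr rfl fun i _ => by rw [map_pow, eval_evalForm_coeff hR]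

/-- **Roy 2013, Step 2 — the product inequality** (test-family form of Prop. 2.4 for `Φ`): for a
convex body `𝒞 ⊆ ℂ[X]_D` (in Roy's sense), `F = Φ(P,Q,·) = c ∏ ℓ_{α_j}^{e_j}` with `∑ e_j ≤ 2^k`,
`sup_{R ∈ 𝒞} |Φ(P, Q, R)| ≤ B`, and any family `R_j ∈ 𝒞`:
`|c| ∏_j |R_j(α_j)|^{e_j} ≤ 2^{2k2^k} B`. [cite: Roy2013, Propositions 2.3–2.4 and §7, Step 2] -/
theorem step2_core (hM₁ : ∀ μ ∈ M₁, μ.degree = 2 * D) (hM₂ : ∀ μ ∈ M₂, μ.degree = 2 * D)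
    (σ : PhiCol D M₁ M₂ ≃ PhiRow D) {P Q : CX} {m : ℕ} {α : Fin m → (Fin 3 → ℂ)} {c : ℂ}
    (hc : c ≠ 0) {e : Fin m → ℕ}
    (hFeq : royF D M₁ M₂ σ P Q = C c * ∏ i, evalForm D (α i) ^ e i)
    {𝒞 : Set CX} (hconv : ∀ R ∈ 𝒞, ∀ S ∈ 𝒞, ∀ a b : ℂ, ‖a‖ + ‖b‖ ≤ 1 → a • R + b • S ∈ 𝒞)
    (hne : 𝒞.Nonempty) (hhom : ∀ R ∈ 𝒞, R.IsHomogeneous D)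
    {B : ℝ} (hB : ∀ R ∈ 𝒞, ‖royPhi D M₁ M₂ σ ![P, Q, R]‖ ≤ B)
    (k : ℕ) (hk : ∑ i, e i ≤ 2 ^ k) (t : Fin m → CX) (ht : ∀ i, t i ∈ 𝒞) :
    ‖c‖ * ∏ i, ‖eval (α i) (t i)‖ ^ e i ≤ 2 ^ (2 * k * 2 ^ k) * B := by
  classical
  -- the linear forms `R ↦ R(α_i)`
  set ℓ : Fin m → (CX →ₗ[ℂ] ℂ) := fun i => (MvPolynomial.aeval (α i) : CX →ₐ[ℂ] ℂ).toLinearMap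
    with hℓ
  have hℓapply : ∀ i (R : CX), ℓ i R = eval (α i) R := fun i R => by
    simp only [hℓ, AlgHom.toLinearMap_apply]
    rfl
  -- the list: `e_i` copies of `(ℓ_i, t_i)`
  set J' := (Σ i : Fin m, Fin (e i))
  set l : List ((CX →ₗ[ℂ] ℂ) × CX) := (univ : Finset J').toList.map fun ji => (ℓ ji.1, t ji.1)
    with hl
  have hlen : l.length ≤ 2 ^ k := by
    rw [hl, List.length_map, Finset.length_toList, Finset.card_univ, Fintype.card_sigma]
    simpa using hk
  have hmem : ∀ x ∈ l, x.2 ∈ 𝒞 := by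
    intro x hx
    rw [hl, List.mem_map] at hx
    obtain ⟨ji, -, rfl⟩ := hx
    exact ht _
  -- products over the list are products with exponents
  have hprod : ∀ {M : Type} [CommMonoid M] (φ : (CX →ₗ[ℂ] ℂ) × CX → M),
      (l.map φ).prod = ∏ i, φ (ℓ i, t i) ^ e i := by
    intro M _ φ
    rw [hl, List.map_map, Finset.prod_map_toList]
    change ∏ ji : J', φ (ℓ ji.1, t ji.1) = _
    rw [Fintype.prod_sigma]
    exact Finset.prod_congr rfl fun i _ => by
      simp only [Finset.prod_const, Finset.card_univ, Fintype.card_fin]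
  -- the bound on `𝒞`
  have hB' : ∀ R ∈ 𝒞, ‖(l.map fun x => x.1 R).prod‖ ≤ B / ‖c‖ := by
    intro R hR
    rw [hprod (fun x => x.1 R)]
    simp only [hℓapply]
    rw [le_div_iff₀ (norm_pos_iff.mpr hc), mul_comm, ← norm_mul,
      ← royPhi_eq_of_royF_eq hM₁ hM₂ σ hFeq (hhom R hR)]
    exact hB R hR
  have h := prod_norm_le_of_prod_bound hconv hne k l hlen hmem hB'
  rw [hprod (fun x => ‖x.1 x.2‖)] at h
  simp only [hℓapply] at h
  rw [mul_div_assoc'] at h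
  rw [mul_comm]
  exact (le_div_iff₀ (norm_pos_iff.mpr hc)).mp h

end Roy2013

end Literature.NumberTheory.Transcendental
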